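import Summits.CriticalPhenomena.PercolationContinuityZ3.Theorems.PercNearOneGluingNoHeavyLowerTailFourPointAtoms
import Summits.CriticalPhenomena.PercolationContinuityZ3.Theorems.PercNearOneGluingAdditiveGluingOneBond
import Summits.CriticalPhenomena.PercolationContinuityZ3.Theorems.PercNearOneGluingNearOneGluingPivotalityDomination
import HarnessLib

/-!
# `NoHeavyLowerTail` (stmt-CriticalPhenomena-4575) — four-point atoms, part 4: the QUOTIENT `a = y` (forcing the apex edge open)

Support file (prover seat `prim-bnk-1`, gen 3; `--supports stmt-CriticalPhenomena-4575`).  No definitions, no named facts, no sorries.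

Two rows of the (L1) certificate live on the contracted graph `G/{a=y}` (Aas–Gladkov and 3PT-LB for `(ay, b, c)`).  Measure-theoretically this is the
weighted graph with the pair `s(a,y)` forced open, `μ' = prodBernoulli (Function.update w s(a,y) 1)`, which is the image of `μ = prodBernoulli w` under
`ω ↦ insert s(a,y) ω` (`goodStepEI_prodBernoulli_map_insert`, tree): `real_update_ay`.  On four-point atoms, inserting the pair `s(a,y)` MERGES the blocks
of `a` and `y` (`ocq`, from `pivDom_reachable_insert`), so every event of the contracted graph is again a sum of cells of the ORIGINAL graph:
the dictionary `real_q<shape>` below (preimages under `insert s(a,y)` of the events of AG / 3PT-LB on `(a,b,c)`).  Consumer: `…L1CertValid`.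
-/

noncomputable section

namespace Summit.CriticalPhenomena.PercolationContinuityZ3.Theorems

open MeasureTheory Set Literature.Probability.Percolation
open Literature.Probability.LatticeModels (prodBernoulli)
open Summit.CriticalPhenomena.PercolationContinuityZ3.Cruxes.AdditiveGluing.TieLine.ConnAtoms

namespace FourPointAtoms

variable {V : Type*}

/-- **Merging `a` and `y`**: on four-point atoms, `{x ↔ z}` after inserting the pair `s(a,y)` has pattern
`π i = π j ∨ (π i = π a ∧ π y = π j) ∨ (π i = π y ∧ π a = π j)` (marked points `x = quad i`, `z = quad j`; `a = quad 0`, `y = quad 3`). [this work] -/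
theorem ocq (a b c y : V) (i j : Fin 4) {x z : V} (hx : quad a b c y i = x) (hz : quad a b c y j = z) :
    HasPattern (quad a b c y) ((fun ω : BondConfig V => insert s(a, y) ω) ⁻¹' openConn x z)
      fun π => π i = π j ∨ (π i = π 0 ∧ π 3 = π j) ∨ (π i = π 3 ∧ π 0 = π j) := by
  subst hx hz
  intro π _ ω hω
  have ha : quad a b c y 0 = a := rfl
  have hy : quad a b c y 3 = y := rfl
  simp only [Set.mem_preimage, openConn, Set.mem_setOf_eq]
  constructor
  · intro h
    rcases pivDom_reachable_insert ω a y (quad a b c y i) (quad a b c y j) h with h1 | ⟨h1, h2⟩ | ⟨h1, h2⟩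
    · exact Or.inl ((hω i j).1 h1)
    · exact Or.inr (Or.inl ⟨(hω i 0).1 (ha ▸ h1), (hω 3 j).1 (hy ▸ h2)⟩)
    · exact Or.inr (Or.inr ⟨(hω i 3).1 (hy ▸ h1), (hω 0 j).1 (ha ▸ h2)⟩)
  · have hmono : ∀ {u v : V}, (openGraph ω).Reachable u v → (openGraph (insert s(a, y) ω)).Reachable u v :=
      fun h => h.mono (openGraph_mono (Set.subset_insert _ _))
    rintro (h | ⟨h1, h2⟩ | ⟨h1, h2⟩)
    · exact hmono ((hω i j).2 h)
    · have hi : (openGraph ω).Reachable (quad a b c y i) a := ha ▸ (hω i 0).2 h1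
      have hj : (openGraph ω).Reachable y (quad a b c y j) := hy ▸ (hω 3 j).2 h2
      by_cases hay : a = y
      · exact hmono (hi.trans (hay ▸ hj))
      · exact (hmono hi).trans (pivDom_reachable_insert_of ω hay hj)
    · have hi : (openGraph ω).Reachable (quad a b c y i) y := hy ▸ (hω i 3).2 h1
      have hj : (openGraph ω).Reachable a (quad a b c y j) := ha ▸ (hω 0 j).2 h2
      by_cases hay : a = y
      · exact hmono (hi.trans (hay ▸ hj))
      · have h' : (openGraph (insert s(y, a) ω)).Reachable y (quad a b c y j) :=
          pivDom_reachable_insert_of ω (Ne.symm hay) hj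
        rw [Sym2.eq_swap] at h'
        exact (hmono hi).trans h'

variable [Fintype V] (w : Sym2 V → unitInterval) (a b c y : V)

/-- **Forcing the apex pair open is the image of `μ` under insertion**: `μ_{w[s(a,y) ↦ 1]}(F) = μ_w((insert s(a,y))⁻¹ F)`. [this work] -/
theorem real_update_ay [DecidableEq V] (F : Set (BondConfig V)) :
    (prodBernoulli (Function.update w s(a, y) 1)).real F =
      (prodBernoulli w).real ((fun ω : BondConfig V => insert s(a, y) ω) ⁻¹' F) := by
  have hmi : Measurable fun ω : BondConfig V => insert s(a, y) ω := by
    refine measurable_set_iff.2 fun i => ?_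
    simp only [Set.mem_insert_iff]
    exact measurable_const.or (measurable_set_mem i)
  rw [← goodStepEI_prodBernoulli_map_insert w s(a, y), map_measureReal_apply hmi MeasurableSet.of_discrete]

/-- `μ(insert ay ⁻¹ openConn a b ∩ (openConn a c)ᶜ)` as a sum of four-point cells. [this work] -/
theorem real_qCabDac : (prodBernoulli w).real ((fun ω : BondConfig V => insert s(a, y) ω) ⁻¹' (openConn a b ∩ (openConn a c)ᶜ)) =
    cell w a b c y 2 + cell w a b c y 6 + cell w a b c y 12 := by
  rw [measureReal_eq_cellSum w a b c y (show HasPattern (quad a b c y) ((fun ω : BondConfig V => insert s(a, y) ω) ⁻¹' (openConn a b ∩ (openConn a c)ᶜ)) _ from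
    ((ocq a b c y 0 1 rfl rfl).inter (ocq a b c y 0 2 rfl rfl).compl))]
  simp (config := {decide := true}) only [ite_true, ite_false]; ring

/-- `μ(insert ay ⁻¹ openConn a c ∩ (openConn a b)ᶜ)` as a sum of four-point cells. [this work] -/
theorem real_qCacDab : (prodBernoulli w).real ((fun ω : BondConfig V => insert s(a, y) ω) ⁻¹' (openConn a c ∩ (openConn a b)ᶜ)) =
    cell w a b c y 1 + cell w a b c y 5 + cell w a b c y 10 := by
  rw [measureReal_eq_cellSum w a b c y (show HasPattern (quad a b c y) ((fun ω : BondConfig V => insert s(a, y) ω) ⁻¹' (openConn a c ∩ (openConn a b)ᶜ)) _ from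
    ((ocq a b c y 0 2 rfl rfl).inter (ocq a b c y 0 1 rfl rfl).compl))]
  simp (config := {decide := true}) only [ite_true, ite_false]; ring

/-- `μ(insert ay ⁻¹ openConn b c ∩ (openConn a b)ᶜ)` as a sum of four-point cells. [this work] -/
theorem real_qCbcDab : (prodBernoulli w).real ((fun ω : BondConfig V => insert s(a, y) ω) ⁻¹' (openConn b c ∩ (openConn a b)ᶜ)) =
    cell w a b c y 3 + cell w a b c y 8 := by
  rw [measureReal_eq_cellSum w a b c y (show HasPattern (quad a b c y) ((fun ω : BondConfig V => insert s(a, y) ω) ⁻¹' (openConn b c ∩ (openConn a b)ᶜ)) _ from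
    ((ocq a b c y 1 2 rfl rfl).inter (ocq a b c y 0 1 rfl rfl).compl))]
  simp (config := {decide := true}) only [ite_true, ite_false]; ring

/-- `μ(insert ay ⁻¹ openConn a b ∩ openConn a c)` as a sum of four-point cells. [this work] -/
theorem real_qCabCac : (prodBernoulli w).real ((fun ω : BondConfig V => insert s(a, y) ω) ⁻¹' (openConn a b ∩ openConn a c)) =
    cell w a b c y 7 + cell w a b c y 9 + cell w a b c y 11 + cell w a b c y 13 + cell w a b c y 14 := by
  rw [measureReal_eq_cellSum w a b c y (show HasPattern (quad a b c y) ((fun ω : BondConfig V => insert s(a, y) ω) ⁻¹' (openConn a b ∩ openConn a c)) _ from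
    ((ocq a b c y 0 1 rfl rfl).inter (ocq a b c y 0 2 rfl rfl)))]
  simp (config := {decide := true}) only [ite_true, ite_false]; ring

/-- `μ(insert ay ⁻¹ (openConn a b)ᶜ ∩ (openConn a c)ᶜ ∩ (openConn b c)ᶜ)` as a sum of four-point cells. [this work] -/
theorem real_qDabDacDbc : (prodBernoulli w).real ((fun ω : BondConfig V => insert s(a, y) ω) ⁻¹' ((openConn a b)ᶜ ∩ (openConn a c)ᶜ ∩ (openConn b c)ᶜ)) =
    cell w a b c y 0 + cell w a b c y 4 := by
  rw [measureReal_eq_cellSum w a b c y (show HasPattern (quad a b c y) ((fun ω : BondConfig V => insert s(a, y) ω) ⁻¹' ((openConn a b)ᶜ ∩ (openConn a c)ᶜ ∩ (openConn b c)ᶜ)) _ from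
    (((ocq a b c y 0 1 rfl rfl).compl.inter (ocq a b c y 0 2 rfl rfl).compl).inter (ocq a b c y 1 2 rfl rfl).compl))]
  simp (config := {decide := true}) only [ite_true, ite_false]; ring

/-- `μ(insert ay ⁻¹ (openConn a b)ᶜ)` as a sum of four-point cells. [this work] -/
theorem real_qDab : (prodBernoulli w).real ((fun ω : BondConfig V => insert s(a, y) ω) ⁻¹' ((openConn a b)ᶜ)) =
    cell w a b c y 0 + cell w a b c y 1 + cell w a b c y 3 + cell w a b c y 4 + cell w a b c y 5 + cell w a b c y 8 + cell w a b c y 10 := by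
  rw [measureReal_eq_cellSum w a b c y (show HasPattern (quad a b c y) ((fun ω : BondConfig V => insert s(a, y) ω) ⁻¹' ((openConn a b)ᶜ)) _ from
    (ocq a b c y 0 1 rfl rfl).compl)]
  simp (config := {decide := true}) only [ite_true, ite_false]; ring

/-- `μ(insert ay ⁻¹ (openConn a c)ᶜ)` as a sum of four-point cells. [this work] -/
theorem real_qDac : (prodBernoulli w).real ((fun ω : BondConfig V => insert s(a, y) ω) ⁻¹' ((openConn a c)ᶜ)) =
    cell w a b c y 0 + cell w a b c y 2 + cell w a b c y 3 + cell w a b c y 4 + cell w a b c y 6 + cell w a b c y 8 + cell w a b c y 12 := by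
  rw [measureReal_eq_cellSum w a b c y (show HasPattern (quad a b c y) ((fun ω : BondConfig V => insert s(a, y) ω) ⁻¹' ((openConn a c)ᶜ)) _ from
    (ocq a b c y 0 2 rfl rfl).compl)]
  simp (config := {decide := true}) only [ite_true, ite_false]; ring

/-- `μ(insert ay ⁻¹ (openConn b c)ᶜ)` as a sum of four-point cells. [this work] -/
theorem real_qDbc : (prodBernoulli w).real ((fun ω : BondConfig V => insert s(a, y) ω) ⁻¹' ((openConn b c)ᶜ)) =
    cell w a b c y 0 + cell w a b c y 1 + cell w a b c y 2 + cell w a b c y 4 + cell w a b c y 5 + cell w a b c y 6 + cell w a b c y 10 + cell w a b c y 12 := by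
  rw [measureReal_eq_cellSum w a b c y (show HasPattern (quad a b c y) ((fun ω : BondConfig V => insert s(a, y) ω) ⁻¹' ((openConn b c)ᶜ)) _ from
    (ocq a b c y 1 2 rfl rfl).compl)]
  simp (config := {decide := true}) only [ite_true, ite_false]; ring

/-- `μ(insert ay ⁻¹ (openConn a c)ᶜ ∩ (openConn b c)ᶜ)` as a sum of four-point cells. [this work] -/
theorem real_qDacDbc : (prodBernoulli w).real ((fun ω : BondConfig V => insert s(a, y) ω) ⁻¹' ((openConn a c)ᶜ ∩ (openConn b c)ᶜ)) =
    cell w a b c y 0 + cell w a b c y 2 + cell w a b c y 4 + cell w a b c y 6 + cell w a b c y 12 := by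
  rw [measureReal_eq_cellSum w a b c y (show HasPattern (quad a b c y) ((fun ω : BondConfig V => insert s(a, y) ω) ⁻¹' ((openConn a c)ᶜ ∩ (openConn b c)ᶜ)) _ from
    ((ocq a b c y 0 2 rfl rfl).compl.inter (ocq a b c y 1 2 rfl rfl).compl))]
  simp (config := {decide := true}) only [ite_true, ite_false]; ring

/-- `μ(insert ay ⁻¹ (openConn a b)ᶜ ∩ (openConn b c)ᶜ)` as a sum of four-point cells. [this work] -/
theorem real_qDabDbc : (prodBernoulli w).real ((fun ω : BondConfig V => insert s(a, y) ω) ⁻¹' ((openConn a b)ᶜ ∩ (openConn b c)ᶜ)) =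
    cell w a b c y 0 + cell w a b c y 1 + cell w a b c y 4 + cell w a b c y 5 + cell w a b c y 10 := by
  rw [measureReal_eq_cellSum w a b c y (show HasPattern (quad a b c y) ((fun ω : BondConfig V => insert s(a, y) ω) ⁻¹' ((openConn a b)ᶜ ∩ (openConn b c)ᶜ)) _ from
    ((ocq a b c y 0 1 rfl rfl).compl.inter (ocq a b c y 1 2 rfl rfl).compl))]
  simp (config := {decide := true}) only [ite_true, ite_false]; ring

/-- `μ(insert ay ⁻¹ (openConn a b)ᶜ ∩ (openConn a c)ᶜ)` as a sum of four-point cells. [this work] -/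
theorem real_qDabDac : (prodBernoulli w).real ((fun ω : BondConfig V => insert s(a, y) ω) ⁻¹' ((openConn a b)ᶜ ∩ (openConn a c)ᶜ)) =
    cell w a b c y 0 + cell w a b c y 3 + cell w a b c y 4 + cell w a b c y 8 := by
  rw [measureReal_eq_cellSum w a b c y (show HasPattern (quad a b c y) ((fun ω : BondConfig V => insert s(a, y) ω) ⁻¹' ((openConn a b)ᶜ ∩ (openConn a c)ᶜ)) _ from
    ((ocq a b c y 0 1 rfl rfl).compl.inter (ocq a b c y 0 2 rfl rfl).compl))]
  simp (config := {decide := true}) only [ite_true, ite_false]; ring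

end FourPointAtoms

end Summit.CriticalPhenomena.PercolationContinuityZ3.Theorems
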